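import Summits.Ventures.LatticeQCDFlow.Scaling.ClusteringFloorAnyAxis

/-!
HONEST FRAMING: exact (Metropolis-corrected) sampling algorithms for lattice gauge theory; figures
of merit are autocorrelation/cost numbers at stated couplings and volumes; no continuum-physics
claim.

# CrossCutFloorUniformR — (U″) ⇒ (U′) FOR EVERY CUT WIDTH WITH ONE STRONG-COUPLING WINDOW:
# `∃ β₀ > 0, ∀ β ∈ (0, β₀], ∀ R, CrossCutCorrelatorFloor d N G ρ β R i j a` (lean-1 GEN-11, ours)

Venture-side (OURS). Cell `lqcd-flow` (pub-lqcd), unit `pub-lqcd-lean-1-g11`, 2026-08-23.  Gens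
8–10 proved the cross-cut floor (U′) `Conjectures.CrossCutCorrelatorFloor d N G ρ β R i j a` at
strong coupling separately for each `R`, with a window `β₀(R)` that shrinks with `R` (the slab-chain
expansion at order `4(2R+1)`).  The clustering floor (U″) of `ClusteringFloorStrongCoupling` /
`ClusteringFloorAnyAxis` is uniform in the separation, so it gives (U′) for EVERY `R` inside ONE
window (the window of `R = 0`):

* `crossCutCorrelatorFloor_of_clusteringFloor` — `ClusteringFloor d N G ρ β i j a →
  CrossCutCorrelatorFloor d N G ρ β R i j a` for every `R` (`s = 2R + 1`, `L₀' = max L₀ (4(2R+1))`,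
  `δ = κ₀ e^{−(2R+1)/ξ}`), as the conjecture's docstring anticipates;
* **`crossCutCorrelatorFloor_allR_of_oneLink`** — for every `(G, ρ)` with one-link data and pairwise
  distinct `i, j, a`: `∃ β₀ > 0, ∀ β ∈ (0, β₀], ∀ R, CrossCutCorrelatorFloor d N G ρ β R i j a`;
  instances `…_sun` (`N ≥ 2`) and `…_u1`.

NOT CLAIMED: negative `β` (gens 8–10 cover `β < 0` for each `R` separately; reflection positivity
needs `β ≥ 0`); `a ∈ {i, j}`.  [folklore] bookkeeping; no new theorem of physics.
-/

noncomputable section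

namespace Summit.Ventures.LatticeQCDFlow.Theory2.Clustering

open MeasureTheory Literature.MathematicalPhysics.QuantumFieldTheory
open Literature.MathematicalPhysics.QuantumLattice (fundamentalRep u1Rep)
open Summit.Ventures.LatticeQCDFlow.Conjectures

section General

variable {d N : ℕ} {G : Type} [Group G] [TopologicalSpace G] [IsTopologicalGroup G]
  [CompactSpace G] [MeasurableSpace G] [BorelSpace G] (ρ : G →* Matrix (Fin N) (Fin N) ℂ)

/-- **(U″) ⇒ (U′) for every cut width** (`s = 2R + 1`; same `β`, `L₀' = max L₀ (4(2R+1))`,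
`δ = κ₀ e^{−(2R+1)/ξ}`). -/
theorem crossCutCorrelatorFloor_of_clusteringFloor {β : ℝ} {i j a : Fin d}
    (h : ClusteringFloor d N G ρ β i j a) (R : ℕ) : CrossCutCorrelatorFloor d N G ρ β R i j a := by
  obtain ⟨κ₀, hκ, ξ, hξ, L₀, h⟩ := h
  refine ⟨κ₀ * Real.exp (-(((2 * R + 1 : ℕ) : ℝ) / ξ)), mul_pos hκ (Real.exp_pos _),
    max L₀ (4 * (2 * R + 1)), fun L _ hL x => ?_⟩
  exact h L (le_of_max_le_left hL) (2 * R + 1) (by have := le_of_max_le_right hL; omega) x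

end General

section OneLink

variable {d N : ℕ} [NeZero d] {G : Type} [Group G] [TopologicalSpace G] [IsTopologicalGroup G]
  [CompactSpace G] [MeasurableSpace G] [BorelSpace G] [SecondCountableTopology G]
  (ρ : G →* Matrix (Fin N) (Fin N) ℂ)

/-- **(U′) FOR EVERY `R` INSIDE ONE STRONG-COUPLING WINDOW**, for every `(G, ρ)` with one-link
data and pairwise distinct `i, j, a`. -/
theorem crossCutCorrelatorFloor_allR_of_oneLink [NeZero N] {θ : ℝ} (h : GroupLayer.OneLink ρ θ)
    {i j a : Fin d} (hij : i ≠ j) (hai : a ≠ i) (haj : a ≠ j) :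
    ∃ β₀ : ℝ, 0 < β₀ ∧ ∀ β : ℝ, 0 < β → β ≤ β₀ →
      ∀ R : ℕ, CrossCutCorrelatorFloor d N G ρ β R i j a := by
  obtain ⟨β₀, hβ₀, hcl⟩ := clusteringFloor_of_oneLink_transverse ρ h hij hai haj
  exact ⟨β₀, hβ₀, fun β hβ hle R => crossCutCorrelatorFloor_of_clusteringFloor ρ (hcl β hβ hle) R⟩

end OneLink

section Instances

variable {d N : ℕ} [NeZero d] {i j a : Fin d}

/-- **`SU(N)`, `N ≥ 2`: (U′) for every `R` inside one strong-coupling window.** -/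
theorem crossCutCorrelatorFloor_allR_sun (hN : 2 ≤ N) (hij : i ≠ j) (hai : a ≠ i) (haj : a ≠ j) :
    ∃ β₀ : ℝ, 0 < β₀ ∧ ∀ β : ℝ, 0 < β → β ≤ β₀ → ∀ R : ℕ,
      CrossCutCorrelatorFloor d N (Matrix.specialUnitaryGroup (Fin N) ℂ) (fundamentalRep (Fin N))
        β R i j a := by
  obtain ⟨β₀, hβ₀, hcl⟩ := clusteringFloor_sun_transverse (d := d) hN hij hai haj
  exact ⟨β₀, hβ₀, fun β hβ hle R =>
    crossCutCorrelatorFloor_of_clusteringFloor (fundamentalRep (Fin N)) (hcl β hβ hle) R⟩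

/-- **`U(1)`: (U′) for every `R` inside one strong-coupling window.** -/
theorem crossCutCorrelatorFloor_allR_u1 (hij : i ≠ j) (hai : a ≠ i) (haj : a ≠ j) :
    ∃ β₀ : ℝ, 0 < β₀ ∧ ∀ β : ℝ, 0 < β → β ≤ β₀ → ∀ R : ℕ,
      CrossCutCorrelatorFloor d 1 Circle u1Rep β R i j a := by
  obtain ⟨β₀, hβ₀, hcl⟩ := clusteringFloor_u1_transverse (d := d) hij hai haj
  exact ⟨β₀, hβ₀, fun β hβ hle R => crossCutCorrelatorFloor_of_clusteringFloor u1Rep (hcl β hβ hle) R⟩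

end Instances

end Summit.Ventures.LatticeQCDFlow.Theory2.Clustering
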